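import Mathlib.Topology.Algebra.InfiniteSum.ENNReal
import Mathlib.Analysis.Real.Sqrt
import Mathlib.Data.Fintype.BigOperators
import HarnessLib

/-!
# Line `kesten-product-renewal-dictionary` (crux stmt-CriticalPhenomena-7117): stub E — SIGN AVERAGING
(Madras–Slade Lemma 8.1.3, Fourier-free form)

Proof file for the registered stub `ms_signAveraging`. Setting: a weight `μ : I → ℝ≥0∞` on a type `I` of
steps, an involution `ρ : I → I` preserving `μ` and negating an integer charge `q : I → ℤ` (for Kesten's
renewal walk: `I` = irreducible bridges, `μ(s) = x_c^{|s|}`, `q` = transversal displacement, `ρ` = reflection).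
The `μ^{⊗m}`-mass of the `m`-tuples `s` of total charge `Σ_k q(s_k) = y` is at most
`√2 · Σ_s Π_k μ(s_k) · (K(s)+1)^{-1/2}`, `K(s) = #{k : q(s_k) ≠ 0}`, GIVEN the Littlewood–Offord count
`#{ε ∈ {±}^m : Σ_k ε_k a_k = y} ≤ √2 · 2^m / √(#{k : a_k ≠ 0} + 1)` (a hypothesis of the stub; it is the
neighbouring stub `ms_littlewoodOfford`).

Proof: for a sign pattern `ε` the flip `s ↦ (k ↦ s_k if ε_k, ρ s_k otherwise)` is a weight-preserving
involution of the tuple space turning the charge `Σ_k q(s_k)` into the signed charge `Σ_k ε_k q(s_k)`;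
reindexing the `tsum` by it and summing over the `2^m` patterns gives
`2^m · mass = Σ_s Π_k μ(s_k) · #{ε : Σ_k ε_k q(s_k) = y}`, and the Littlewood–Offord count is applied
pointwise in `s`; finally `2^m` is cancelled. All sums live in `ℝ≥0∞`, so every rearrangement is unconditional.

Source: N. Madras, G. Slade, *The Self-Avoiding Walk* (1993), §8.1, Lemma 8.1.3.
-/

noncomputable section

open scoped ENNReal NNReal BigOperators
open Classical

namespace Summit.CriticalPhenomena.SAWScalingLimit.Theorems.CriticalBubbleBound.Kesten.MS

/-- The sign flip `s ↦ (k ↦ if ε k then s k else ρ (s k))` of an `m`-tuple along a pattern `ε` is an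
involution when `ρ` is. [folklore] -/
theorem ms_signAveraging_flip_involutive {I : Type} {ρ : I → I} (hρ : Function.Involutive ρ) {m : ℕ}
    (ε : Fin m → Bool) :
    Function.Involutive (fun s : Fin m → I => fun k => if ε k then s k else ρ (s k)) := by
  intro s
  funext k
  cases h : ε k <;> simp [h, hρ (s k)]

/-- Reindexing the tuple mass by the sign flip along `ε`: the charge-`y` mass equals the mass of the tuples
whose `ε`-signed charge is `y` (the flip is a weight-preserving bijection, `μ ∘ ρ = μ`, `q ∘ ρ = -q`).
[folklore] -/
theorem ms_signAveraging_reindex {I : Type} (μ : I → ℝ≥0∞) {ρ : I → I} (q : I → ℤ)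
    (hρ : Function.Involutive ρ) (hμ : ∀ i, μ (ρ i) = μ i) (hq : ∀ i, q (ρ i) = -q i) {m : ℕ}
    (ε : Fin m → Bool) (y : ℤ) :
    (∑' s : Fin m → I, if (∑ k, q (s k)) = y then ∏ k, μ (s k) else 0) =
      ∑' s : Fin m → I, if (∑ k, (if ε k then q (s k) else -q (s k))) = y then ∏ k, μ (s k) else 0 := by
  refine (Equiv.tsum_eq ((ms_signAveraging_flip_involutive hρ ε).toPerm _)
    (fun s : Fin m → I => if (∑ k, q (s k)) = y then ∏ k, μ (s k) else 0)).symm.trans ?_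
  refine tsum_congr fun s => ?_
  have h1 : ∀ k, q (if ε k then s k else ρ (s k)) = if ε k then q (s k) else -q (s k) := by
    intro k
    cases h : ε k <;> simp [hq (s k)]
  have h2 : ∀ k, μ (if ε k then s k else ρ (s k)) = μ (s k) := by
    intro k
    cases h : ε k <;> simp [hμ (s k)]
  simp only [Function.Involutive.coe_toPerm, h1, h2]

/-- Summing the flipped masses over the `2^m` sign patterns: `2^m ·` (charge-`y` mass) is the `tsum` over
tuples `s` of `#{ε : Σ_k ε_k q(s_k) = y} · Π_k μ(s_k)`. [folklore] -/
theorem ms_signAveraging_average {I : Type} (μ : I → ℝ≥0∞) {ρ : I → I} (q : I → ℤ)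
    (hρ : Function.Involutive ρ) (hμ : ∀ i, μ (ρ i) = μ i) (hq : ∀ i, q (ρ i) = -q i) (m : ℕ) (y : ℤ) :
    (2 : ℝ≥0∞) ^ m * (∑' s : Fin m → I, if (∑ k, q (s k)) = y then ∏ k, μ (s k) else 0) =
      ∑' s : Fin m → I,
        ((((Finset.univ : Finset (Fin m → Bool)).filter
            (fun ε => (∑ k, (if ε k then q (s k) else -q (s k))) = y)).card : ℕ) : ℝ≥0∞) *
          ∏ k, μ (s k) := by
  have hcard : (2 : ℝ≥0∞) ^ m = ((Finset.univ : Finset (Fin m → Bool)).card : ℝ≥0∞) := by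
    rw [Finset.card_univ, Fintype.card_fun, Fintype.card_bool, Fintype.card_fin]
    push_cast
    rfl
  calc (2 : ℝ≥0∞) ^ m * (∑' s : Fin m → I, if (∑ k, q (s k)) = y then ∏ k, μ (s k) else 0)
      = ∑ ε : Fin m → Bool,
          ∑' s : Fin m → I, if (∑ k, (if ε k then q (s k) else -q (s k))) = y then ∏ k, μ (s k) else 0 := by
        rw [hcard, ← nsmul_eq_mul, ← Finset.sum_const]
        exact Finset.sum_congr rfl fun ε _ => ms_signAveraging_reindex μ q hρ hμ hq ε y
    _ = ∑' s : Fin m → I, ∑ ε : Fin m → Bool,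
          if (∑ k, (if ε k then q (s k) else -q (s k))) = y then ∏ k, μ (s k) else 0 :=
        (Summable.tsum_finsetSum fun _ _ => ENNReal.summable).symm
    _ = _ := by
        refine tsum_congr fun s => ?_
        rw [← Finset.sum_filter, Finset.sum_const, nsmul_eq_mul]

/-- E `ms_signAveraging` — for a weight `μ` on a type `I` invariant under an involution `ρ` that negates an
integer charge `q`, the `μ^{⊗m}`-mass of `m`-tuples of total charge `y` is at most
`√2 · Σ_s Π_k μ(s_k) · (K(s)+1)^{-1/2}`, `K(s) = #{k : q(s_k) ≠ 0}` (average over the `2^m` sign flips, then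
the Littlewood–Offord count pointwise — taken as the fourth hypothesis). [cite: MadrasSlade1993, Lemma 8.1.3] -/
theorem ms_signAveraging : ∀ {I : Type} (μ : I → ℝ≥0∞) (ρ : I → I) (q : I → ℤ), Function.Involutive ρ → (∀ i, μ (ρ i) = μ i) → (∀ i, q (ρ i) = -q i) → (∀ (m : ℕ) (a : Fin m → ℤ) (y : ℤ), (((Finset.univ : Finset (Fin m → Bool)).filter (fun ε => (∑ k, (if ε k then a k else -a k)) = y)).card : ℝ) ≤ Real.sqrt 2 * 2 ^ m / Real.sqrt (((Finset.univ : Finset (Fin m)).filter (fun k => a k ≠ 0)).card + 1)) → ∀ (m : ℕ) (y : ℤ), (∑' s : Fin m → I, if (∑ k, q (s k)) = y then ∏ k, μ (s k) else 0) ≤ ENNReal.ofReal (Real.sqrt 2) * ∑' s : Fin m → I, (∏ k, μ (s k)) * ENNReal.ofReal (1 / Real.sqrt (((Finset.univ : Finset (Fin m)).filter (fun k => q (s k) ≠ 0)).card + 1)) := by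
  intro I μ ρ q hρ hμ hq hLO m y
  -- pointwise Littlewood–Offord bound, cast into `ℝ≥0∞` and with `2^m` pulled out
  have hpt : ∀ s : Fin m → I,
      ((((Finset.univ : Finset (Fin m → Bool)).filter
          (fun ε => (∑ k, (if ε k then q (s k) else -q (s k))) = y)).card : ℕ) : ℝ≥0∞) * ∏ k, μ (s k) ≤
        (2 : ℝ≥0∞) ^ m * (ENNReal.ofReal (Real.sqrt 2) * ((∏ k, μ (s k)) *
          ENNReal.ofReal (1 / Real.sqrt
            (((Finset.univ : Finset (Fin m)).filter (fun k => q (s k) ≠ 0)).card + 1)))) := by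
    intro s
    have hcnt : (((Finset.univ : Finset (Fin m → Bool)).filter
        (fun ε => (∑ k, (if ε k then q (s k) else -q (s k))) = y)).card : ℝ) ≤
          Real.sqrt 2 * 2 ^ m /
            Real.sqrt (((Finset.univ : Finset (Fin m)).filter (fun k => q (s k) ≠ 0)).card + 1) :=
      hLO m (fun k => q (s k)) y
    have hK : ((((Finset.univ : Finset (Fin m → Bool)).filter
        (fun ε => (∑ k, (if ε k then q (s k) else -q (s k))) = y)).card : ℕ) : ℝ≥0∞) ≤
          (2 : ℝ≥0∞) ^ m * (ENNReal.ofReal (Real.sqrt 2) * ENNReal.ofReal (1 / Real.sqrt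
            (((Finset.univ : Finset (Fin m)).filter (fun k => q (s k) ≠ 0)).card + 1))) := by
      rw [← ENNReal.ofReal_natCast]
      refine (ENNReal.ofReal_le_ofReal hcnt).trans_eq ?_
      rw [show Real.sqrt 2 * 2 ^ m /
            Real.sqrt (((Finset.univ : Finset (Fin m)).filter (fun k => q (s k) ≠ 0)).card + 1) =
          (2 : ℝ) ^ m * (Real.sqrt 2 * (1 / Real.sqrt
            (((Finset.univ : Finset (Fin m)).filter (fun k => q (s k) ≠ 0)).card + 1))) by ring,
        ENNReal.ofReal_mul (by positivity), ENNReal.ofReal_mul (Real.sqrt_nonneg _),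
        ENNReal.ofReal_pow (by norm_num), ENNReal.ofReal_ofNat]
    calc _ ≤ (2 : ℝ≥0∞) ^ m * (ENNReal.ofReal (Real.sqrt 2) * ENNReal.ofReal (1 / Real.sqrt
            (((Finset.univ : Finset (Fin m)).filter (fun k => q (s k) ≠ 0)).card + 1))) * ∏ k, μ (s k) :=
          mul_le_mul_left hK _
      _ = _ := by ring
  -- sum the pointwise bound and cancel `2^m`
  have hfin : (2 : ℝ≥0∞) ^ m * (∑' s : Fin m → I, if (∑ k, q (s k)) = y then ∏ k, μ (s k) else 0) ≤
      (2 : ℝ≥0∞) ^ m * (ENNReal.ofReal (Real.sqrt 2) * ∑' s : Fin m → I, (∏ k, μ (s k)) *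
        ENNReal.ofReal (1 / Real.sqrt
          (((Finset.univ : Finset (Fin m)).filter (fun k => q (s k) ≠ 0)).card + 1))) := by
    rw [ms_signAveraging_average μ q hρ hμ hq m y, ← ENNReal.tsum_mul_left, ← ENNReal.tsum_mul_left]
    exact ENNReal.tsum_le_tsum hpt
  exact (ENNReal.mul_le_mul_iff_right (ENNReal.pow_pos (by norm_num) m).ne'
    (ENNReal.pow_ne_top ENNReal.ofNat_ne_top)).1 hfin

end Summit.CriticalPhenomena.SAWScalingLimit.Theorems.CriticalBubbleBound.Kesten.MS

end
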